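import Summits.Ventures.PercRepro.TheoremOAll
import Summits.Ventures.PercRepro.SixFourRule

/-!
# PercRepro — the `(6, 4)` frame: C-025 at `(6, 4)` on every matroid, modulo the per-solid balance on its core (p3, gen 9)

mine-2's `MINE2-RLS.md` §21.0 / §21.8 with p2's `SixThreeFrame.lean` pattern: C-025 at `(6, 4)` on EVERY finite
matroid follows from its simple core by the `|E|`-induction of §14 / §16 Step 0, and on the core from the
PER-SOLID BALANCE `0 ≤ J_t(G)` at the type `t = typeOf M G` of every solid `G` (`SixFourRule.lean`).

* `phiK_six_four`: `Φ(6, 4) = 6/5`;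
* a LOOP halves both counts (p3's halving lemmas, `RLS_six_four_of_loop`);
* a PARALLEL PAIR is Theorem F (`c025_step_of_delete_contract`) with the induction hypothesis at `(6, 4)` on
  `M ＼ {e}` and Theorem O at `(5, 3)` on `M ／ {e}` (`ThmO.c025_five_three_all`, `RLS_six_four_of_parallel`);
* a COLOOP at `ρ(E) = 6`: `#U_M(6, 4) = #U_{M′}(5, 4)` and `#Y_M(6, 4) = W₅(M′) + W₄(M′) ≥ 2 · #U_{M′}(5, 4)` by the
  two injections of typer-2's `MatroidColoopWindow` (`RLS_six_four_of_coloop`; `2 ≥ 6/5`, no induction needed);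
* `ρ(E) < 6` makes `U(6, 4)` empty; otherwise `M` is simple with `ρ(E) ≥ 6`, coloop-free when `ρ(E) = 6`: the core.

**`rls_six_four_of_core`**: the core on every simple matroid of rank `≥ 6` (coloop-free at rank `6`) gives C-025 at
`(6, 4)` on EVERY finite matroid.  **`rls_six_four_of_perSolid`**: the same from the per-solid balance — if every
solid `G` of every such core matroid satisfies `0 ≤ J M G (typeOf M G)`, then `(6/5) · #U(6, 4) ≤ #Y(6, 4)` on every
finite matroid (`PerFlat.c025_of_perFlat_normalized` with the hard max-trace rule and `perSolid_of_J_nonneg`).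
`SixFourTransfer.lean` says which types are in the kernel (`t ≤ 2`, the `g = 10` cell at `t = 3`, Theorem 22 at
`t = 4`) and states the residue.
-/

open scoped Matroid

namespace PercRepro

namespace SixFour

open Finset Set ThmN

variable {α : Type}

/-- `Φ(6, 4) = 6/5`. -/
theorem phiK_six_four : phiK 6 4 = 6 / 5 := by
  unfold phiK
  rw [show Finset.Ioo 4 6 = {5} from by decide, Finset.sum_singleton,
    show Nat.choose 10 5 = 252 by decide, show Nat.choose 10 6 = 210 by decide]
  norm_num

/-- The loop step at `(6, 4)` (p3's halving lemmas). -/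
theorem RLS_six_four_of_loop (M : Matroid α) [M.Finite] {e : α} (he : M.IsLoop e)
    (h : RLS (M ＼ {e}) 6 4) : RLS M 6 4 := by
  unfold RLS at h ⊢
  have he' : e ∈ M.loops := he
  rw [ncard_U_eq_two_mul_of_loop he' 6 4, ncard_Y_eq_two_mul_of_loop he' 6 4]
  push_cast at h ⊢
  linarith

/-- The coloop step at `(6, 4)`: `#Y_M = W₅(M′) + W₄(M′) ≥ 2 · #U_{M′}(5, 4) = 2 · #U_M ≥ (6/5) · #U_M`
(`M′ = M ＼ {e}`; no induction hypothesis is needed). -/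
theorem RLS_six_four_of_coloop (M : Matroid α) [M.Finite] {e : α} (he : M.IsColoop e)
    (hR : M.eRank = (6 : ℕ)) : RLS M 6 4 := by
  classical
  have hU : Matroid.topCount M (5 + 1) (3 + 1) = Matroid.topCount (M.delete {e}) 5 (3 + 1) :=
    Matroid.topCount_eq_of_isColoop_of_eRank he 3 hR
  have hY : Matroid.midCount M (5 + 1) 4 = Matroid.levelCount M 5 := by
    rw [Matroid.midCount_eq_sum (5 + 1) 4 (by omega), show Finset.Ioo 4 (5 + 1) = {5} from by decide,
      Finset.sum_singleton]
  have hlev5 : Matroid.levelCount M (4 + 1) = Matroid.levelCount (M ＼ {e}) (4 + 1) +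
      Matroid.levelCount (M ＼ {e}) 4 := Matroid.levelCount_succ_eq_of_isColoop he 4
  have htop : Matroid.topCount (M.delete {e}) 5 4 ≤ Matroid.levelCount (M.delete {e}) 5 :=
    Matroid.topCount_le_levelCount_top 5 4
  have hbot : Matroid.topCount (M.delete {e}) 5 4 ≤ Matroid.levelCount (M.delete {e}) 4 :=
    Matroid.topCount_le_levelCount_bot 5 4
  -- translate to the C025 body
  show phiK 6 4 * (Matroid.topCount M 6 4 : ℚ) ≤ (Matroid.midCount M 6 4 : ℚ)
  rw [phiK_six_four]
  have hU' : Matroid.topCount M 6 4 = Matroid.topCount (M.delete {e}) 5 4 := hU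
  have hY6 : Matroid.midCount M 6 4 = Matroid.levelCount M 5 := hY
  have hlev5' : Matroid.levelCount M 5 = Matroid.levelCount (M.delete {e}) 5 +
      Matroid.levelCount (M.delete {e}) 4 := hlev5
  rw [hU', hY6, hlev5']
  push_cast
  have h1 : (Matroid.topCount (M.delete {e}) 5 4 : ℚ) ≤ Matroid.levelCount (M.delete {e}) 5 := by
    exact_mod_cast htop
  have h2 : (Matroid.topCount (M.delete {e}) 5 4 : ℚ) ≤ Matroid.levelCount (M.delete {e}) 4 := by
    exact_mod_cast hbot
  have h0 : (0 : ℚ) ≤ Matroid.topCount (M.delete {e}) 5 4 := by positivity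
  linarith

/-- Theorem F's step at `(6, 4)`: a parallel pair reduces `RLS M 6 4` to `RLS (M ＼ {e}) 6 4` and `(5, 3)` on
`M ／ {e}`, which is Theorem O. -/
theorem RLS_six_four_of_parallel (M : Matroid α) [M.Finite] {e e' : α} (he : M.Indep {e})
    (he' : e' ∈ M.E) (hne : e' ≠ e) (hpar : e ∈ M.closure {e'}) (h1 : RLS (M ＼ {e}) 6 4) : RLS M 6 4 := by
  have key := c025_step_of_delete_contract he (spans_of_parallel he' hne hpar) 5 3
  have h2 : RLS (M ／ {e}) 5 3 := ThmO.c025_five_three_all (M ／ {e})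
  unfold RLS at h1 h2 ⊢
  simp only [show (5 + 1 : ℕ) = 6 from rfl, show (3 + 1 : ℕ) = 4 from rfl] at key
  exact key h1 h2

/-- **C-025 at `(6, 4)` on every finite matroid, modulo its simple coloop-free core** (the `|E|`-induction of
`MINE2-RLS.md` §14/§16 Step 0 at `(6, 4)`): if every simple matroid of rank `≥ 6` that is coloop-free when its rank is
`6` satisfies `RLS · 6 4`, then every finite matroid does — loops halve, parallel pairs by Theorem F + Theorem O at
`(5, 3)`, a coloop at `ρ(E) = 6` by the coloop step, `ρ(E) < 6` trivially. -/
theorem rls_six_four_of_core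
    (hcore : ∀ (M : Matroid α) [M.Finite], ThmH.Simple M → (6 : ℕ∞) ≤ M.eRank →
      (M.eRank = 6 → ∀ e, ¬ M.IsColoop e) → RLS M 6 4)
    (M : Matroid α) [M.Finite] : RLS M 6 4 := by
  suffices H : ∀ n : ℕ, ∀ (M : Matroid α) [M.Finite], M.E.ncard = n → RLS M 6 4 from H _ M rfl
  intro n
  induction n using Nat.strong_induction_on with
  | _ n ih =>
  intro M _ hn
  classical
  have hdel : ∀ e ∈ M.E, (M ＼ {e}).E.ncard < n := by
    intro e he
    rw [Matroid.delete_ground, ← hn, ← Set.ncard_sdiff_singleton_add_one he M.ground_finite]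
    omega
  -- Case 1: a loop
  by_cases hL : ∃ e ∈ M.E, M.IsLoop e
  · obtain ⟨e, he, hloopE⟩ := hL
    exact RLS_six_four_of_loop M hloopE (ih _ (hdel e he) (M ＼ {e}) rfl)
  push Not at hL
  -- Case 2: a parallel pair
  by_cases hP : ∃ e ∈ M.E, ∃ e' ∈ M.E, e' ≠ e ∧ e ∈ M.closure {e'}
  · obtain ⟨e, he, e', he', hne, hpar⟩ := hP
    have heI : M.Indep {e} := Matroid.indep_singleton.2 ((Matroid.not_isLoop_iff he).1 (hL e he))
    exact RLS_six_four_of_parallel M heI he' hne hpar (ih _ (hdel e he) (M ＼ {e}) rfl)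
  push Not at hP
  -- Case 3: simple
  have hs : ThmH.Simple M :=
    fun e he f hf hef => eRk_pair_eq_two_of_simple M hL (fun e he e' he' hne => hP e he e' he' hne) he hf hef
  rcases lt_or_ge M.eRank (6 : ℕ∞) with hlt | hge
  · exact RLS_of_eRank_lt M (p := 6) (q := 4) (by exact_mod_cast hlt)
  by_cases hC : M.eRank = 6 ∧ ∃ e, M.IsColoop e
  · obtain ⟨hR, e, hcol⟩ := hC
    exact RLS_six_four_of_coloop M hcol (by exact_mod_cast hR)
  · have hcolfree : M.eRank = 6 → ∀ e, ¬ M.IsColoop e := fun hR e hcol => hC ⟨hR, e, hcol⟩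
    exact hcore M hs hge hcolfree

/-- **C-025 at `(6, 4)` on every finite matroid from the per-solid balance on the core**: if on every simple matroid
of rank `≥ 6` (coloop-free at rank `6`) every solid `G` (rank-`4` flat) satisfies `0 ≤ J M G (typeOf M G)` — the
balance `Σ_{B ∈ R₄(G)} (6 − t) w_∞(B) ≥ (6/5)(N₄ − DF_t)` at its type `t = 6 − ρ(E ∖ G)` — then
`(6/5) · #U(6, 4) ≤ #Y(6, 4)` on every finite matroid (`RLS M 6 4`).  The hard max-trace rule `fHard` is the
normalised weighting of `PerFlat.c025_of_perFlat_normalized`, and `perSolid_of_J_nonneg` is its per-flat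
inequality. -/
theorem rls_six_four_of_perSolid [DecidableEq α]
    (hsolid : ∀ (M : Matroid α) [M.Finite], ThmH.Simple M → (6 : ℕ∞) ≤ M.eRank →
      (M.eRank = 6 → ∀ e, ¬ M.IsColoop e) → ∀ G ∈ PerFlat.flatsQ M 4, 0 ≤ J M G (typeOf M G))
    (M : Matroid α) [M.Finite] : RLS M 6 4 := by
  apply rls_six_four_of_core
  intro M _ hs hge hcol
  unfold RLS
  rw [phiK_six_four]
  apply PerFlat.c025_of_perFlat_normalized M 6 4 (by norm_num) (fHard M) (fun P S => fHard_nonneg P S)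
  intro G hG
  exact perSolid_of_J_nonneg hG (hsolid M hs hge hcol G hG)

end SixFour

end PercRepro
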